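import Summits.Ventures.PercRepro.C025ProfilePLDTruncate
import Summits.Ventures.PercRepro.C025ProfilePLDSimplePaving
import Summits.Ventures.PercRepro.C025ProfilePLDClosureParallel

/-!
# PER-LAYER DOMINANCE ON TRUNCATIONS OF «RANK ≤ 2 / SIMPLIFICATION-PAVING ⊕ PARALLEL CLASSES (⊕ FREE POINTS)» (night-3 g30)

`proofs/NIGHT3-G30-PAREXT.md` §6.  The closures compose: g28's (PLD) for rank `≤ 2` (`PavingPLD.pld_of_eRank_le_two`) or this
gen's (PLD) for the simplification-paving class, then g29's direct sum with parallel classes (free points are classes of one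
element), then truncation (`PLDTruncate.pld_truncate`).  In particular EVERY `T_r(U_{2,k} ⊕ free points)` — the simple
rank-4 matroids `U_{4,m+k}` with `k` collinear points among them — satisfies PER-LAYER DOMINANCE
(`pld_truncate_eRank_le_two_parallelClasses`), and C-025 holds at every `(p, q)` on every further truncation with free
points (`rls_truncate_truncate_eRank_le_two_parallelClasses_freeOn`).  No `def`, no `instance`, no notation.  Axioms: standard.
-/

open scoped Matroid

namespace PercRepro

open Finset ThmH

namespace PLDTruncate

variable {α β : Type} [DecidableEq α] [DecidableEq β]

/-- (PLD) on every truncation of «M ⊕ parallel classes» for `M` of rank `≤ 2` — e.g. every `T_r(U_{2,k} ⊕ free points)`. -/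
theorem pld_truncate_eRank_le_two_parallelClasses (M : Matroid α) [M.Finite] (h2 : M.eRank ≤ 2)
    (c : α → β) (E₂ : Finset α) (h : Disjoint M.E (E₂ : Set α)) (r : ℕ) :
    haveI := PLDClosure.disjointSum_comapOn_finite M c E₂ h
    ∀ lo hi δ Θ : ℕ, Θ ≤ lo + hi + δ → (lo = 0 ∨ lo + hi + δ ≤ Θ) →
      (∑ I ∈ (gr (Matroid.truncate (M.disjointSum ((Matroid.freeOn (Set.univ : Set β)).comapOn (E₂ : Set α) c) h)
          r)).powerset,
        (if lo ≤ ((Matroid.truncate (M.disjointSum ((Matroid.freeOn (Set.univ : Set β)).comapOn (E₂ : Set α) c) h)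
              r).eRk (I : Set α)).toNat ∧
            ((Matroid.truncate (M.disjointSum ((Matroid.freeOn (Set.univ : Set β)).comapOn (E₂ : Set α) c) h)
              r).eRk (I : Set α)).toNat ≤ hi ∧
            Θ ≤ ((Matroid.truncate (M.disjointSum ((Matroid.freeOn (Set.univ : Set β)).comapOn (E₂ : Set α) c) h)
              r).eRk ((gr (Matroid.truncate (M.disjointSum ((Matroid.freeOn (Set.univ : Set β)).comapOn (E₂ : Set α) c)
                h) r) \ I : Finset α) : Set α)).toNat +
              ((Matroid.truncate (M.disjointSum ((Matroid.freeOn (Set.univ : Set β)).comapOn (E₂ : Set α) c) h)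
                r).eRk (I : Set α)).toNat then
          (((Matroid.truncate (M.disjointSum ((Matroid.freeOn (Set.univ : Set β)).comapOn (E₂ : Set α) c) h)
            r).eRk ((gr (Matroid.truncate (M.disjointSum ((Matroid.freeOn (Set.univ : Set β)).comapOn (E₂ : Set α) c)
              h) r) \ I : Finset α) : Set α)).toNat).choose δ
        else 0)) ≤
      ∑ I ∈ (gr (Matroid.truncate (M.disjointSum ((Matroid.freeOn (Set.univ : Set β)).comapOn (E₂ : Set α) c) h)
          r)).powerset,
        (if lo + δ ≤ ((Matroid.truncate (M.disjointSum ((Matroid.freeOn (Set.univ : Set β)).comapOn (E₂ : Set α) c) h)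
              r).eRk ((gr (Matroid.truncate (M.disjointSum ((Matroid.freeOn (Set.univ : Set β)).comapOn (E₂ : Set α) c)
                h) r) \ I : Finset α) : Set α)).toNat ∧
            ((Matroid.truncate (M.disjointSum ((Matroid.freeOn (Set.univ : Set β)).comapOn (E₂ : Set α) c) h)
              r).eRk ((gr (Matroid.truncate (M.disjointSum ((Matroid.freeOn (Set.univ : Set β)).comapOn (E₂ : Set α) c)
                h) r) \ I : Finset α) : Set α)).toNat ≤ hi + δ then
          (((Matroid.truncate (M.disjointSum ((Matroid.freeOn (Set.univ : Set β)).comapOn (E₂ : Set α) c) h)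
            r).eRk ((gr (Matroid.truncate (M.disjointSum ((Matroid.freeOn (Set.univ : Set β)).comapOn (E₂ : Set α) c)
              h) r) \ I : Finset α) : Set α)).toNat).choose δ
        else 0) := by
  haveI := PLDClosure.disjointSum_comapOn_finite M c E₂ h
  exact pld_truncate _ (PLDClosure.pld_disjointSum_parallelClasses M (PavingPLD.pld_of_eRank_le_two M h2) c E₂ h) r

/-- C-025 AT EVERY `(p, q)` ON EVERY TRUNCATION OF «T_r(M ⊕ parallel classes) ⊕ FREE POINTS» for `M` of rank `≤ 2` —
in particular on every truncation of «(U_{4,m+k} with k collinear points) ⊕ free points». -/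
theorem rls_truncate_truncate_eRank_le_two_parallelClasses_freeOn (M : Matroid α) [M.Finite] (h2 : M.eRank ≤ 2)
    (c : α → β) (E₂ : Finset α) (h : Disjoint M.E (E₂ : Set α)) (r₀ : ℕ) (E₃ : Finset α)
    (h₃ : Disjoint (M.disjointSum ((Matroid.freeOn (Set.univ : Set β)).comapOn (E₂ : Set α) c) h).E (E₃ : Set α))
    (r p q : ℕ) :
    haveI := PLDClosure.disjointSum_comapOn_finite M c E₂ h
    haveI := PLDBridge.disjointSum_freeOn_finite
      (Matroid.truncate (M.disjointSum ((Matroid.freeOn (Set.univ : Set β)).comapOn (E₂ : Set α) c) h) r₀) E₃ h₃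
    ThmN.RLS (PercRepro.Matroid.truncate
      ((Matroid.truncate (M.disjointSum ((Matroid.freeOn (Set.univ : Set β)).comapOn (E₂ : Set α) c) h)
        r₀).disjointSum (Matroid.freeOn (E₃ : Set α)) h₃) r) p q := by
  haveI := PLDClosure.disjointSum_comapOn_finite M c E₂ h
  exact PLDBridge.rls_disjointSum_freeOn_of_pld
    (Matroid.truncate (M.disjointSum ((Matroid.freeOn (Set.univ : Set β)).comapOn (E₂ : Set α) c) h) r₀) E₃ h₃ r p q
    (pld_truncate_eRank_le_two_parallelClasses M h2 c E₂ h r₀)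

/-- (PLD) on every truncation of «M ⊕ parallel classes» for `M` whose simplification is paving. -/
theorem pld_truncate_simplificationPaving_parallelClasses (M : Matroid α) [M.Finite]
    (hsp : ∀ C, M.IsCircuit C → C.encard ≤ 2 ∨ M.eRank ≤ C.encard)
    (c : α → β) (E₂ : Finset α) (h : Disjoint M.E (E₂ : Set α)) (r : ℕ) :
    haveI := PLDClosure.disjointSum_comapOn_finite M c E₂ h
    ∀ lo hi δ Θ : ℕ, Θ ≤ lo + hi + δ → (lo = 0 ∨ lo + hi + δ ≤ Θ) →
      (∑ I ∈ (gr (Matroid.truncate (M.disjointSum ((Matroid.freeOn (Set.univ : Set β)).comapOn (E₂ : Set α) c) h)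
          r)).powerset,
        (if lo ≤ ((Matroid.truncate (M.disjointSum ((Matroid.freeOn (Set.univ : Set β)).comapOn (E₂ : Set α) c) h)
              r).eRk (I : Set α)).toNat ∧
            ((Matroid.truncate (M.disjointSum ((Matroid.freeOn (Set.univ : Set β)).comapOn (E₂ : Set α) c) h)
              r).eRk (I : Set α)).toNat ≤ hi ∧
            Θ ≤ ((Matroid.truncate (M.disjointSum ((Matroid.freeOn (Set.univ : Set β)).comapOn (E₂ : Set α) c) h)
              r).eRk ((gr (Matroid.truncate (M.disjointSum ((Matroid.freeOn (Set.univ : Set β)).comapOn (E₂ : Set α) c)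
                h) r) \ I : Finset α) : Set α)).toNat +
              ((Matroid.truncate (M.disjointSum ((Matroid.freeOn (Set.univ : Set β)).comapOn (E₂ : Set α) c) h)
                r).eRk (I : Set α)).toNat then
          (((Matroid.truncate (M.disjointSum ((Matroid.freeOn (Set.univ : Set β)).comapOn (E₂ : Set α) c) h)
            r).eRk ((gr (Matroid.truncate (M.disjointSum ((Matroid.freeOn (Set.univ : Set β)).comapOn (E₂ : Set α) c)
              h) r) \ I : Finset α) : Set α)).toNat).choose δ
        else 0)) ≤
      ∑ I ∈ (gr (Matroid.truncate (M.disjointSum ((Matroid.freeOn (Set.univ : Set β)).comapOn (E₂ : Set α) c) h)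
          r)).powerset,
        (if lo + δ ≤ ((Matroid.truncate (M.disjointSum ((Matroid.freeOn (Set.univ : Set β)).comapOn (E₂ : Set α) c) h)
              r).eRk ((gr (Matroid.truncate (M.disjointSum ((Matroid.freeOn (Set.univ : Set β)).comapOn (E₂ : Set α) c)
                h) r) \ I : Finset α) : Set α)).toNat ∧
            ((Matroid.truncate (M.disjointSum ((Matroid.freeOn (Set.univ : Set β)).comapOn (E₂ : Set α) c) h)
              r).eRk ((gr (Matroid.truncate (M.disjointSum ((Matroid.freeOn (Set.univ : Set β)).comapOn (E₂ : Set α) c)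
                h) r) \ I : Finset α) : Set α)).toNat ≤ hi + δ then
          (((Matroid.truncate (M.disjointSum ((Matroid.freeOn (Set.univ : Set β)).comapOn (E₂ : Set α) c) h)
            r).eRk ((gr (Matroid.truncate (M.disjointSum ((Matroid.freeOn (Set.univ : Set β)).comapOn (E₂ : Set α) c)
              h) r) \ I : Finset α) : Set α)).toNat).choose δ
        else 0) := by
  haveI := PLDClosure.disjointSum_comapOn_finite M c E₂ h
  exact pld_truncate _
    (PLDClosure.pld_disjointSum_parallelClasses M (PLDParExt.pld_of_simplification_paving M hsp) c E₂ h) r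

end PLDTruncate

end PercRepro
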